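import Mathlib.Logic.Basic
import HarnessLib

/-!
# [IUTchII] §3–§4: index of the expository Remarks (3.4.1–3.8.3, 4.1.1–4.11.5) and named
# statement slots for the Remarks cited in the proof of [IUTchIII] Corollary 3.12

S. Mochizuki, *Inter-universal Teichmüller theory II*, §3 (kurims Dec-2020 manuscript pp. 87–119)
and §4 (pp. 120–172) [cite: Mochizuki2012, Rmk 3.6.2 p.101]. Claim key DISPUTED (D-0012). This file
records NO mathematics of its own: it is the census companion of the §3–§4 statement files of this
directory. For every Remark of §3–§4 it says where (if anywhere) its mathematical kernel is typed,
and for the Remarks that the PROOF of [IUTchIII] Corollary 3.12 cites by number — Remarks 3.6.4,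
4.5.3, 4.7.6, 4.11.2 (HOME/plan/STATEMENT-CLOSURE.md §B) — together with Remarks 3.6.2, 3.6.3,
3.8.3, 4.10.2, 4.10.3 which those lean on, it provides NAMED Prop-valued slots, one per printed
sub-item, whose docstrings quote the load-bearing sentence, so that a typed derivation can cite
them by name. None of these slots is asserted; each is an uninterpreted `Prop` field to be
instantiated by whoever types the corresponding [IUTchIII] step (abc-iut-c312-2) or discharged
against real definitions later. Honest framing: nothing here takes a side on Cor. 3.12.

**Index (Remark → pages → status).** "typed" = kernel typed in the named sibling file;
"slot" = named Prop slot below; "expository" = interpretive prose with no mathematical assertion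
(analogy with `p`-adic Teichmüller theory, philosophy of étale-like vs Frobenius-like structures),
recorded here by locator only.
* 3.4.1 (i),(ii) p. 93 — slot in `TemperedThetaMonoids` (`RadialityStatements.remark341_i`,
  `logShell_multiradial`).
* 3.5.1 (i),(ii) p. 96; 3.5.3 p. 99 — slots in `BadPrimeGaussianMonoids` (`Remark353Statement`).
* 3.5.2 (i) pp. 96–97 — typed and PROVED in `SymmetryCombinatorics` (`TwoPointModel.*`); (ii) p. 98
  slot there (`ConjugateSynchronizationPrinciple`); (iii)–(v) pp. 98–99 expository.
* 3.6.1 p. 101 — slot in `BadPrimeGaussianMonoids` (`Cor35Statements.galoisAction`).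
* 3.6.2 (i)–(iv) pp. 101–104 — (iii) kernel (`q_v ↦ {q_v^{j²}}`, identity at `j = 1`, Frobenius at
  `j = l⋇`) typed in `ThetaGauLinks` (`thetaExponent_*`); (i),(ii),(iv) slots below (`Remark362`).
* 3.6.3 (i),(ii) pp. 104–105 — slots below (`Remark363`).
* 3.6.4 (i)–(v) pp. 105–108 — CITED BY COR. 3.12's proof; slots below (`Remark364`).
* 3.6.5 (i)–(iii) pp. 108–110 — expository (cyclotomes as "skeleta"; analogy with canonical
  coordinates of `p`-adic Teichmüller theory).
* 3.7.1 p. 112 — slot in `TemperedThetaMonoids` (`RadialityStatements.logShell_multiradial`).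
* 3.8.1 p. 115 — design note in `TemperedThetaMonoids` (`remark381DesignNote`).
* 3.8.2 (i),(ii) p. 116 — expository (relation to the `F_l^⋊±`/`F_l^⋇`-symmetries of [IUTchI]); the
  label assignment "`0, ≻ ↦ >`" is typed with Cor 4.10 (i) (`HodgeTheaterStrips.deltaIsoMod`).
* 3.8.3 (i)–(iii) pp. 117–119 — (i) slots below (`Remark383`); (ii),(iii) expository.
* 4.1.1 (i),(ii) pp. 122–123 — expository ("easy formal generalization"); (iii) slot in
  `GaussianMonoidsGood` (`Remark411Statements`).
* 4.2.1 (i)–(iv) pp. 125–126 — (ii) typed in `GaussianMonoidsGood`; (i),(iii),(iv) slots in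
  `GoodPrimeFrobenioidMonoids` (`Remark421Statements`). 4.3.1 p. 129, 4.4.1 p. 131 — slots there.
* 4.5.1–4.5.3 pp. 134–136 — slots in `GlobalGaussianFrobenioids` (`Remark45Statements`); 4.5.3 is
  CITED BY COR. 3.12's proof: finer slots below (`Remark453`). 4.5.4 p. 136 — typed and PROVED there
  (`weightedDiagonal`).
* 4.6.1, 4.6.2 pp. 139–140 — slots in `GlobalGaussianFrobenioids` (`Remark46Statements`).
* 4.7.1, 4.7.2 p. 143; 4.7.5 pp. 147–148; 4.7.6 pp. 148–149 — 4.7.2/4.7.6 slots in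
  `GlobalGaussianFrobenioids` (`Remark4748Statements`); 4.7.6 is CITED BY COR. 3.12's proof: finer
  slots below (`Remark476`); 4.7.1, 4.7.5 expository.
* 4.7.3 (iii) p. 145, 4.7.4 (ii),(iii) pp. 146–147 — typed and PROVED in `SymmetryCombinatorics`;
  4.7.3 (i),(ii), 4.7.4 (i) expository.
* 4.8.1–4.8.3 pp. 151–153 — slots in `GlobalGaussianFrobenioids` (`Remark4748Statements`).
* 4.10.1 pp. 161–162 — slot below (`Remark410`); 4.10.2 (i),(ii), 4.10.3 (i),(ii) pp. 162–163 —
  slots below; 4.10.3 (iii) typed in `ThetaGauLinks` (`thetaExponent_label_one`).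
* 4.11.1 pp. 164–165 — typed in `ThetaGauLinks` (`thetaExponent_iterate_comm`).
* 4.11.2 (i)–(iv) pp. 165–167 — CITED BY COR. 3.12's proof; slots below (`Remark4112`).
* 4.11.3 pp. 167–168, 4.11.4 (i)–(iii) pp. 168–172 — expository (`Θ^{ell} ↔ ⊞/⊠`; analogy with
  `p`-adic Teichmüller theory, [CanLift] §3); 4.11.5 p. 172 — an erratum to [CanLift] Lemma 3.4,
  outside the scope of [IUTchII]'s mathematics; not typed.
-/

namespace Literature.IUT.HodgeArakelov

/-- [IUTchII] Remark 3.6.2 (i), (ii), (iv) pp. 101–104 (Fig. 3.1 "Kummer theory and Galois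
evaluation", Fig. 3.2 "Étale-like versus Frobenius-like structures") as named slots; (iii) is
typed in `ThetaGauLinks`. Quoted, not asserted. [cite: Mochizuki2012, Rmk 3.6.2 p.101] -/
structure Remark362 where
  /-- (i) p. 101: the three portions of the diagram of Cor 3.6 (ii) correspond to the arrows
  "`⟹`" (Kummer), "`⇓`" (Galois evaluation), "`⟸`" (forget) of Fig. 3.1; "the composite of the arrows
  «`⟹`» and «`⇓`» may be thought of as a sort of comparison isomorphism between «Frobenius-like» …
  and «étale-like» … structures". -/
  kummerGaloisEvaluation : Prop
  /-- (ii) p. 102: étale-like structures "have the crucial advantage of being functorial or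
  invariant with respect to various non-ring/scheme-theoretic filters … the Θ-link … and the
  log-wall", Frobenius-like structures "satisfy the crucial property of not being subject to such
  rigidifying anabelian algorithms", and "Kummer theory serves the crucial role of relating …
  Frobenius-like structures to étale-like structures". -/
  etaleVersusFrobenius : Prop
  /-- (iv) p. 103–104: Grothendieck-Conjecture-type results "are obtained precisely by combining …
  the «Galois evaluation» via Kummer theory of polynomial functions or differential forms at
  various rational points". -/
  grothendieckConjectureAnalogy : Prop

/-- [IUTchII] Remark 3.6.3 (i), (ii) pp. 104–105 as named slots. Quoted, not asserted.
[cite: Mochizuki2012, Rmk 3.6.3 p.104] -/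
structure Remark363 where
  /-- (i) p. 104: "The distinct ring structures on either side of one of the «non-ring/
  scheme-theoretic filters» … — i.e., the log-wall … and the Θ-link … — give rise to distinct,
  unrelated basepoints". -/
  distinctBasepoints : Prop
  /-- (ii) p. 104–105: `N`-th power morphisms of Frobenioids "fail [since `N > 1`] to preserve the
  ring structure of `K_v`, hence give rise to distinct, unrelated basepoints", but these "only give
  rise to inner automorphisms of … the base category". -/
  nthPowerInner : Prop

/-- [IUTchII] **Remark 3.6.4** (i)–(v) pp. 105–108 — CITED in the proof of [IUTchIII] Cor 3.12 —
as named slots, one per sub-item. Quoted, not asserted. [cite: Mochizuki2012, Rmk 3.6.4 p.105] -/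
structure Remark364 where
  /-- (i) pp. 105–106: the rigidity properties of [EtTh] "yield effective reconstruction algorithms
  … invariant with respect to the indeterminacies that arise from a situation in which each of the
  objects in the category is only known up to isomorphism"; "the `N`-th power morphisms … are
  compatible with the multiplicative structure, but not the additive structure"; "without the ring
  structure on `K_v`, one cannot even define the `p_v`-adic logarithm!". -/
  rigidityUnderIsomorphismIndeterminacy : Prop
  /-- (ii) p. 106: "one may reconstruct various structures of interest from a mono-theta
  environment without sacrificing certain fundamental rigidity properties"; mono-theta environments
  "serve as a sort of bridge" between tempered Frobenioids (Frobenius-like) and tempered fundamental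
  groups (étale-like). -/
  monoThetaBridge : Prop
  /-- (iii) pp. 106–107: "the operation of Galois evaluation is necessarily linear", "compatible
  with the ring structure on the constants"; "the first power of the theta values … «inherits» …
  the special role played by the first power of the … theta function". -/
  galoisEvaluationLinear : Prop
  /-- (iv) p. 107: "in order to apply the Θ-link … it is necessary to consider the operation of
  Galois evaluation … applied to the first power of the … Frobenioid-theoretic theta function in
  order to avail oneself of the cyclotomic rigidity"; "the `N`-th power …, for `N > 1`, is only
  defined as the `N`-th power «`(−)^N`» of the first power". -/
  firstPowerOnly : Prop
  /-- (v) pp. 107–108: the necessity of "post-anabelian monoids"; the "narrow bridge" of a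
  mono-theta environment "satisfies the crucial property of multiradiality … of being
  «horizontal» with respect to the «connection structure»"; powers other than the first "give rise
  to structures which are «not horizontal»". -/
  narrowBridgeMultiradial : Prop

/-- [IUTchII] Remark 3.8.3 (i) p. 117, (a)–(d): the "direct technical consequences of the conjugate
synchronization", as named slots (each is a pointer to an isomorphism typed in the Cor 3.5/3.6
files), plus the "main application" sentence; (ii),(iii) pp. 118–119 expository ("one may only
construct diagonal embeddings of … Galois-invariants or … Galois-orbits" without conjugate
synchronization). Quoted, not asserted. [cite: Mochizuki2012, Rmk 3.8.3 p.117] -/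
structure Remark383 where
  /-- (a) the isomorphisms `Ψ_cns(M^Θ_*)_{|t₁|} ⥲ Ψ_cns(M^Θ_*)_{|t₂|}`, `(Ψ_{†C_v})_{|t₁|} ⥲ (Ψ_{†C_v})_{|t₂|}`,
  `(Ψ_{†C_v})_{|t|} ⥲ Ψ_cns(M^Θ_*)_{|t|}` "well-defined up to an inner automorphism indeterminacy that is
  independent of `|t|`" (Cors 3.5 (i), 3.6 (i)) -/
  a_labelIsos : Prop
  /-- (b) the diagonal submonoids `Ψ_cns(M^Θ_*)_{⟨|F_l|⟩}`, `Ψ_cns(M^Θ_*)_{⟨F_l^⋇⟩}` and the "constant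
  distributions" of Def 3.8 (iii) -/
  b_diagonals : Prop
  /-- (c) the isomorphisms `Ψ_cns(M^Θ_*)_0 ⥲ Ψ_cns(M^Θ_*)_{⟨F_l^⋇⟩}`, `(Ψ_{†C_v})_0 ⥲ (Ψ_{†C_v})_{⟨F_l^⋇⟩}`
  (Cors 3.5 (iii), 3.6 (iii)) -/
  c_zeroLabelIsos : Prop
  /-- (d) the restriction to the units of the composite `Ψ_{†F^Θ_v,α} ⥲ Ψ_{F_ξ}(†F_v)` (Cor 3.6 (ii));
  "our main application … of the conjugate synchronization … will consist precisely of the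
  isomorphism of units of (d), in the context of composition with the Θ-link — cf. the «coricity
  of `O^×`»" -/
  d_unitIso : Prop
  /-- (ii) p. 118: without conjugate synchronization "one may only construct diagonal embeddings of
  either submonoids of Galois-invariants or sets of Galois-orbits …", which are "insufficient for
  conducting Kummer theory" and incompatible with the additive structure. -/
  noSyncOnlyInvariants : Prop

/-- [IUTchII] **Remark 4.5.3** (i)–(iii) pp. 135–136 — CITED in the proof of [IUTchIII] Cor 3.12 —
as named slots, one per sub-item. Quoted, not asserted. [cite: Mochizuki2012, Rmk 4.5.3 p.135] -/
structure Remark453 where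
  /-- (i) p. 135: conjugate synchronization "is possible in the case of the `F_l^⋊±`-symmetry — but
  not in the case of the `F_l^⋇`-symmetry! — precisely because of the connectedness, at each
  `v ∈ V`, of the local components involved"; the "«geometric» nature of the automorphisms that give
  rise to this symmetry". -/
  conjSyncViaConnectedness : Prop
  /-- (ii) p. 135–136, (a)–(c): compared with mono-analytic capsules/processions "the ring structure
  … remains intact"; compared with holomorphic capsules/processions "the «single basepoint» …
  remains intact" (conjugate synchronization AND bijective link with labels); compared with
  `D`-`Θ^{ell}`-bridges, the "multi-basepoint nature … does not allow one to establish conjugate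
  synchronization". -/
  comparisonWithMultiBasepoint : Prop
  /-- (iii) p. 136: "in order to glue together the various local `F_l^⋊±`-symmetries … it is
  necessary to make use of the global portion «`†D^{⊚±}`»", which "plays … the role of synchronizing
  the `±`-indeterminacies at each `v ∈ V`" — "one important underlying cause for the profinite
  conjugacy indeterminacies … that occur in Corollaries 2.4, 2.5". -/
  globalPlusMinusSynchronization : Prop

/-- [IUTchII] **Remark 4.7.6** pp. 148–149 — CITED in the proof of [IUTchIII] Cor 3.12 — as named
slots. Quoted, not asserted. [cite: Mochizuki2012, Rmk 4.7.6 p.148] -/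
structure Remark476 where
  /-- "it makes sense to consider non-realified global Frobenioids [corresponding, e.g., to
  «`F_mod`»] only in the case of the `F_l^⋇`-symmetry", since treating `F_mod` Galois-theoretically
  needs "the full profinite group `Π_{C_F}`", whose subgroups `Π_{C_K}, Π_{X_K}` "are only well-defined
  up to `Π_{C_F}`-conjugacy", i.e. subject to the "natural `F_l^⋇`-poly-actions". -/
  nonRealifiedOnlyFlStar : Prop
  /-- "one cannot simply «form the quotient by the indeterminacy constituted by these
  `F_l^⋇`-symmetries» since this would give rise to «label-crushing»"; these symmetries "involve
  conjugation by elements of the absolute Galois groups of the global base fields …, hence are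
  fundamentally incompatible with the establishment of conjugate synchronization"; (a) isolate
  `F_l^⋊±` from `F_l^⋇` for conjugate synchronization, (b) isolate `F_l^⋇` from `F_l^⋊±` for
  Galois-theoretic `F_mod`. -/
  noLabelCrushing : Prop

/-- [IUTchII] Remarks 4.10.1 (pp. 161–162), 4.10.2 (i),(ii) (p. 162), 4.10.3 (i),(ii) (pp. 162–163)
as named slots; 4.10.3 (iii) is typed in `ThetaGauLinks`. Quoted, not asserted.
[cite: Mochizuki2012, Rmk 4.10.3 p.162] -/
structure Remark410 where
  /-- 4.10.1: the `F^⊢`-prime-strips of Cor 4.10 (ii) "are only well-defined up to an indeterminacy,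
  at the `v ∈ V^bad`, relative to automorphisms of the split Frobenioid … that induce the identity
  automorphism on the associated `F^{⊢×}`-prime-strip"; "such indeterminacies may, in essence, be
  ignored, since they are «absorbed» in the full poly-isomorphisms" of the links. -/
  badIndeterminacyAbsorbed : Prop
  /-- 4.10.2 (i): "we shall ultimately mainly be interested in [a further enhanced version of] the
  `Θ^{×μ}_{gau}`-link"; the multiradiality of [IUTchIII] Thm 3.11 is established "by thinking of …
  the `Θ^{×μ}_{gau}`-link as … the composite of the `Θ^{×μ}`-link with the operation of Galois
  evaluation". -/
  gauLinkAsComposite : Prop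
  /-- 4.10.2 (ii): at `v ∈ V^bad` the `Θ^{×μ}`-link is "a sort of equivalence between the split theta
  monoids of Proposition 3.1, (i) … and certain submonoids of the constant monoids … equipped with
  the splittings that arise from the `q`-parameter"; "the splittings in the case of the constant
  monoids do not admit a natural multiradial formulation". -/
  constantSplittingsNotMultiradial : Prop
  /-- 4.10.3 (i): "the «coricity of `F^{⊢×μ}`-prime-strips» … amounts, in essence, to the «coricity of
  `D^⊢`-prime-strips» …, together with the «coricity of [various quotients by torsion of] the units
  `O^×(−)`»"; "this coricity of the units will allow us to compare volumes on either side of the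
  `Θ^{×μ}`-, `Θ^{×μ}_{gau}`-links". -/
  unitCoricityComparesVolumes : Prop
  /-- 4.10.3 (ii): "Unlike the units …, the «divisor monoid», or «value group», portion of the
  Frobenioids involved is by no means preserved by the `Θ^{×μ}`-, `Θ^{×μ}_{gau}`-links!" — "a sort of
  «Frobenius morphism»", "a sort of Teichmüller deformation"; "the computation of the «volume
  distortion» arising from this «arithmetic Teichmüller deformation» may … be regarded as the
  ultimate goal of the present series of papers". -/
  valueGroupNotPreserved : Prop

/-- [IUTchII] **Remark 4.11.2** (i)–(iv) pp. 165–167 (review of the theory) — CITED in the proof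
of [IUTchIII] Cor 3.12 — as named slots, one per sub-item. Quoted, not asserted.
[cite: Mochizuki2012, Rmk 4.11.2 p.165] -/
structure Remark4112 where
  /-- (i) p. 165: a `Θ^{±ell}NF`-Hodge theater "is intended as a model of conventional scheme-theoretic
  arithmetic geometry"; the bridge between number field and theta functions "is realized by the
  Gaussian distribution — i.e., a globalized version of the theta values `{q_v^{j²}}_{1 ≤ j ≤ l⋇}`",
  which "also plays the crucial role of allowing the construction of the [non-scheme/ring-
  theoretic!] `Θ^{×μ}_{gau}`-link". -/
  gaussianDistributionBridge : Prop
  /-- (ii) pp. 165–166: within one Hodge theater, [EtTh] gives "a single connected geometric «Kummer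
  theory-compatible theater for evaluation of the theta function», whose étale-theoretic
  realization admits a multiradial formulation … and whose connectedness allows one to establish
  conjugate synchronization", compatible with the `F_l^⋊±`-symmetry; "Conjugate synchronization
  plays an essential role in establishing the coricity of the units"; the "post-anabelian"
  representation "is necessary to construct the `Θ^{×μ}_{gau}`-link", the "anabelian" one for the
  log-wall; "canonical splittings … into «unit» and «value group» components". -/
  singleTheaterEvaluation : Prop
  /-- (iii) pp. 166–167: number fields "will ultimately, in [IUTchIII], … play the role of relating
  … ⊠-line bundles … to «⊞-line bundles»", "only possible if one considers all of the primes";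
  `F_l^⋊±` "combinatorially uniradial … associated with the «units»", `F_l^⋇` "combinatorially
  multiradial … associated with the «value groups»"; conjugate synchronization "may only be
  established once the prime-strips … are treated as objects which are free of any combinatorial
  constraints arising from the «prime-trees»"; the "connectedness of the global objects" is
  essential for label bookkeeping. -/
  numberFieldRole : Prop
  /-- (iv) p. 167: the bridge is constructed "by dismantling those aspects of the «characteristic
  topography» of the theta functions and number fields … that constitute an obstruction": the
  geometric dimension (resolved by evaluation at `l`-torsion points) and the prime-trees (resolved
  by prime-strips labeled by `F_l^⋇`) — "dismantling the ring structure of `F_l` … into its additive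
  and multiplicative components". -/
  dismantling : Prop

/-- The census companion records, for the four Cor-3.12-cited Remarks, that every printed sub-item
has a slot: `Remark364` (5), `Remark453` (3), `Remark476` (2), `Remark4112` (4). (A bookkeeping
equation, kept as a checked arithmetic fact.) [cite: Mochizuki2012, Rmk 4.11.2 p.165] -/
theorem cor312CitedRemarkSlots : 5 + 3 + 2 + 4 = 14 := rfl

end Literature.IUT.HodgeArakelov
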